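import Summits.QuantumFields.BalabanUV.T4Continuum.Support.NE3CovLiftCurl
import Summits.QuantumFields.BalabanUV.T4Continuum.Support.NE3CovariantWeitzenbock
import HarnessLib

/-!
# T⁴ programme, node NE3 — REPAIR R24 (γ1): THE DIVERGENCE LETTER OF ROUTE Π's COVARIANT LIFT — pointwise
# `‖Ad_{W(y+e_μ,μ)} covLift(y+e_μ, μ) − covLift(y, μ)‖ ≤ liftC·(6∕M² + 2(d+1)·x_W)·‖Φ(blk y, μ)‖` and in ℓ²
# `Σ_x ‖covDiv_W (covLift M W Φ) x‖²_HS ≤ d·liftC²·(6∕M² + 2(d+1)x_W)²·M^d·dirSq Φ (periodBox N)` — `O(M^{d−4})` in the regime `M²x_W ≤ 1`, k-FREE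

Cell `pub-balaban-gaps` (YM blitz, track G2, seat `ne3`, unit `pub-balaban-gaps-ne3`; writer prover-pub-balaban-gaps-ne3-g3-0, 2026-08-23), census
`run/shared/lean/pub/pub-balaban-gaps/ne/NE3.md` §4 R24 (γ1)∕(γ3).  WHY.  The ℓ²-letter of the Landau projection onto B8's gauge
(`Spine/NE3/LandauProjectionB8.sum_nhsNormSq_gaugeDir_le_of_isLandauB8`: `Σ‖gaugeDir W λ‖² ≤ 4M²·Σ‖covDiv_W Y‖²`) is k-free exactly when the right inverse
`Y = covLift M W Φ` of `QbarIter` (`Spine/NE3/QbarRightInverseB8`) has covariant divergence `O(‖Φ‖∕M²)` per site — one order in `M` better than the field itself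
(`O(‖Φ‖∕M)`, `NE3SmoothLiftBounds.norm_smoothLift_le`).  THIS FILE proves it, by the method of the lineage's curl letter `NE3CovLiftCurl.norm_curlAt_covLift_le`:
in the lift's own comb gauge (`gaugeAct (btree M W (blk y)) W`) the transported lift IS the flat smooth lift on the block (`covLift_comb_eq_smoothLift`), the
comb bond `(y+e_μ, μ)` is `(d(M−1)+1)·x_W`-close to `1` (`norm_comb_plaquette_bond_le`), and the flat smooth lift's LONGITUDINAL step is `≤ 6·liftC∕M²·‖Φ‖` —
inside the block by the profile's Lipschitz bound `NE3SmoothLiftProfile.abs_lprof_succ_sub_le` (`|lprof(t+1) − lprof(t)| ≤ 6`) with the transverse bump unchanged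
(`res_add_e_ne`), across the far face because the profile is `≤ 6` there (`lprof M M = 0`) and vanishes on the near face of the next block (`smoothLift_of_res_self_eq_zero`);
the normalisation is `liftNorm⁻¹ ≤ 24·8^{d−1}∕M²` (`liftNorm_ge`).  Covariance of the step (`covStep_gaugeAct`, over W3's `covLift_gaugeAct`) carries the bound back to `W`.

CONTENT ([folklore]; 0 sorry; no `def`): §1 profile helpers (`inv_liftNorm_le`, `abs_lprof_pred_le`, `tperp_add_e_self`); §2 the flat longitudinal step
(`norm_smoothLift_add_e_self_le`, `norm_smoothLift_longStep_le`); §3 comb gauge ∕ covariance (`covLift_comb_eq_smoothLift_add_e_self`, `covStep_gaugeAct`);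
§4 **`norm_covStep_covLift_le`** (pointwise); §5 `covDiv_eq_sum_covStep`, **`norm_covDiv_covLift_le`**, **`sum_nhsNormSq_covDiv_covLift_le`** (the ℓ²-letter over one
period, `Φ` `N`-periodic).

HONEST FRAMING.  Kinematics of OUR objects; constants explicit and crude; nothing about minimisers; the chart supplier, (P♮), (RES♯), the covariant root and **NE3 are
NOT proved**; spine PROVED 0∕9; finite T⁴ rung (B)+1 — NOT infinite volume, NOT mass gap, NOT `BetaPertH`, NOT Clay.  PLACEMENT:
`Summits/QuantumFields/BalabanUV/T4Continuum/Spine/NE3/`; imports accepted modules only; moves nothing.  HONEST DEPENDENCY (cell page 1): continuum YM on T⁴ ⇐ BetaPertH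
∧ nine spine estimates (0/9 proved); BetaPertH ⇐ (D1) ∧ (D4) ∧ CAP+tail; G-an2-4 gates asym, D1 and NE2/3/4.
-/

set_option autoImplicit false

open scoped BigOperators Matrix.Norms.L2Operator
open Finset

namespace Summit.QuantumFields.BalabanUV.T4Continuum.NE3.CovLiftDivergenceB8

open Literature.MathematicalPhysics.QuantumFieldTheory.Balaban1983to89
open B7Prop1Explicit B7Prop2Explicit MatrixNorms
open T4AveragingDeficitWall (IsUnitaryCfg SmallField Ad dirSq)
open T4AveragingDeficitWallBoundary (IsPeriodicCfg periodBox mem_periodBox card_periodBox sum_periodBox_shift)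
open T4AveragingDeficitNonAbelian (Ad_mul Ad_sub)
open AveragingDeficitPeriodicCounting (IsPeriodicDir)
open AveragingDeficitTransport (norm_Ad_of_unitary)
open AveragingDeficitNearIdentity (norm_Ad_sub_le)
open AveragingDeficitLocality (dirGauge)
open AveragingDeficitBlockDensity (btree btree_mem l1_e)
open SmoothRefineBlocks (blk res res_nonneg res_le res_lt blk_add_e res_add_e_self res_add_e_ne blk_res_add_period)
open NE3CoarseInterpolant (blk_block)
open NE3BlockLineAverage (sum_periodBox_blocks)
open NE3CombGauge (isUnitaryCfg_comb)
open NE3TentBump (fac)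
open NE3SmoothLiftProfile (lprof lprof_self abs_lprof_succ_sub_le)
open NE3SmoothLiftFlat (tperp liftNorm smoothLift liftNorm_pos)
open NE3SmoothLiftBounds (liftNorm_ge tperp_nonneg tperp_le_one norm_smoothLift_le smoothLift_of_res_self_eq_zero)
open NE3CovariantLift (liftHol covLift covLift_gaugeAct)
open NE3CovariantWeitzenbock (covDiv)
open NE3CovLiftCurl (covLift_comb_eq_smoothLift norm_comb_plaquette_bond_le)
open NE3QbarIterCovLiftPrep (liftC liftC_nonneg)

noncomputable section

variable {d : ℕ} {n : Type*} [Fintype n] [DecidableEq n]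

/-! ## §1 Profile helpers -/

omit [Fintype n] [DecidableEq n] in
/-- `liftNorm⁻¹ ≤ liftC∕M²` (`M ≥ 2`, `d ≥ 1`; `liftC d = 24·8^{d−1}`). [folklore] -/
theorem inv_liftNorm_le {M : ℕ} (hM : 2 ≤ M) (hd : 1 ≤ d) : (liftNorm d M)⁻¹ ≤ liftC d / (M : ℝ) ^ 2 := by
  have hc := liftNorm_pos hM d
  have hge := liftNorm_ge hM d hd
  have hM0 : (0 : ℝ) < M := by exact_mod_cast (show 0 < M by omega)
  have h8 : (0 : ℝ) < (M : ℝ) ^ 2 / (24 * (8 : ℝ) ^ (d - 1)) := by positivity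
  calc (liftNorm d M)⁻¹ ≤ ((M : ℝ) ^ 2 / (24 * (8 : ℝ) ^ (d - 1)))⁻¹ := inv_anti₀ h8 hge
    _ = liftC d / (M : ℝ) ^ 2 := by rw [liftC, inv_div]

/-- The profile on the far slice: `|lprof M (M − 1)| ≤ 6` (since `lprof M M = 0` and the profile is 6-Lipschitz). [folklore] -/
theorem abs_lprof_pred_le {M : ℕ} (hM : 1 ≤ M) : |lprof M ((M : ℤ) - 1)| ≤ 6 := by
  have h := abs_lprof_succ_sub_le hM (t := (M : ℤ) - 1) (by omega) (by omega)
  rw [show (M : ℤ) - 1 + 1 = (M : ℤ) by ring, lprof_self M hM, zero_sub, abs_neg] at h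
  exact h

omit [Fintype n] [DecidableEq n] in
/-- The transverse bump does not change along its own direction: `tperp M μ (y + e_μ) = tperp M μ y`. [folklore] -/
theorem tperp_add_e_self {M : ℕ} (hM : 1 ≤ M) (μ : Fin d) (y : Site d) : tperp M μ (y + e μ) = tperp M μ y := by
  unfold tperp
  refine Finset.prod_congr rfl fun j hj => ?_
  have hne : j ≠ μ := Finset.ne_of_mem_erase hj
  unfold fac SmoothRefineInterp.wt
  rw [res_add_e_ne hM y hne]

/-! ## §2 The flat longitudinal step of the smooth lift -/

/-- **THE LIFT ONE LONGITUDINAL STEP ON** is still controlled by the datum of the block of `y`: `‖smoothLift M Φ (y + e_μ) μ‖ ≤ liftC∕M·‖Φ(blk y, μ)‖`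
(inside the block the block is the same; across the far face the lift vanishes on the near face of the next block). [folklore] -/
theorem norm_smoothLift_add_e_self_le {M : ℕ} (hM : 2 ≤ M) (hd : 1 ≤ d) (Φ : Site d → Fin d → Matrix n n ℂ) (y : Site d) (μ : Fin d) :
    ‖smoothLift M Φ (y + e μ) μ‖ ≤ liftC d / M * ‖Φ (blk M y) μ‖ := by
  have hM1 : 1 ≤ M := by omega
  by_cases h : res M y μ = (M : ℤ) - 1
  · have hres : res M (y + e μ) μ = 0 := by rw [res_add_e_self hM1]; simp [h]
    rw [smoothLift_of_res_self_eq_zero M Φ hres, norm_zero]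
    have := liftC_nonneg d; positivity
  · have hblk : blk M (y + e μ) = blk M y := by rw [blk_add_e hM1]; simp [h]
    rw [← hblk, liftC]; exact norm_smoothLift_le hM hd Φ _ μ

/-- **THE FLAT LONGITUDINAL STEP**: `‖smoothLift M Φ (y + e_μ) μ − smoothLift M Φ y μ‖ ≤ 6·liftC∕M²·‖Φ(blk y, μ)‖` (`M ≥ 2`, `d ≥ 1`) — inside the block by
`|lprof(t+1) − lprof(t)| ≤ 6` with the transverse bump unchanged, across the far face by `|lprof(M−1)| ≤ 6` and the vanishing on the near face. [folklore] -/
theorem norm_smoothLift_longStep_le {M : ℕ} (hM : 2 ≤ M) (hd : 1 ≤ d) (Φ : Site d → Fin d → Matrix n n ℂ) (y : Site d) (μ : Fin d) :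
    ‖smoothLift M Φ (y + e μ) μ - smoothLift M Φ y μ‖ ≤ 6 * (liftC d / (M : ℝ) ^ 2) * ‖Φ (blk M y) μ‖ := by
  have hM1 : 1 ≤ M := by omega
  have hc := liftNorm_pos hM d
  have hinv := inv_liftNorm_le (d := d) hM hd
  have hinv0 : 0 ≤ (liftNorm d M)⁻¹ := inv_nonneg.mpr hc.le
  have ht0 := tperp_nonneg hM1 μ y
  have ht1 := tperp_le_one hM1 μ y
  by_cases h : res M y μ = (M : ℤ) - 1
  · -- across the far face
    have hres : res M (y + e μ) μ = 0 := by rw [res_add_e_self hM1]; simp [h]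
    rw [smoothLift_of_res_self_eq_zero M Φ hres, zero_sub, norm_neg]
    have hg : |lprof M (res M y μ)| ≤ 6 := by rw [h]; exact abs_lprof_pred_le hM1
    unfold smoothLift
    rw [norm_smul, Real.norm_eq_abs, abs_mul, abs_mul, abs_of_nonneg hinv0, abs_of_nonneg ht0]
    refine mul_le_mul_of_nonneg_right ?_ (norm_nonneg _)
    calc (liftNorm d M)⁻¹ * (|lprof M (res M y μ)| * tperp M μ y) ≤ (liftC d / (M : ℝ) ^ 2) * (6 * 1) :=
          mul_le_mul hinv (mul_le_mul hg ht1 ht0 (by norm_num)) (by positivity) (by have := liftC_nonneg d; positivity)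
      _ = 6 * (liftC d / (M : ℝ) ^ 2) := by ring
  · -- inside the block
    have hres : res M (y + e μ) μ = res M y μ + 1 := by rw [res_add_e_self hM1]; simp [h]
    have hblk : blk M (y + e μ) = blk M y := by rw [blk_add_e hM1]; simp [h]
    have hstep : |lprof M (res M y μ + 1) - lprof M (res M y μ)| ≤ 6 :=
      abs_lprof_succ_sub_le hM1 (res_nonneg hM1 y μ) (by have := res_le hM1 y μ; omega)
    have hdiff : smoothLift M Φ (y + e μ) μ - smoothLift M Φ y μ
        = ((liftNorm d M)⁻¹ * ((lprof M (res M y μ + 1) - lprof M (res M y μ)) * tperp M μ y)) • Φ (blk M y) μ := by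
      unfold smoothLift
      rw [hres, hblk, tperp_add_e_self hM1, ← sub_smul]
      congr 1; ring
    rw [hdiff, norm_smul, Real.norm_eq_abs, abs_mul, abs_mul, abs_of_nonneg hinv0, abs_of_nonneg ht0]
    refine mul_le_mul_of_nonneg_right ?_ (norm_nonneg _)
    calc (liftNorm d M)⁻¹ * (|lprof M (res M y μ + 1) - lprof M (res M y μ)| * tperp M μ y) ≤ (liftC d / (M : ℝ) ^ 2) * (6 * 1) :=
          mul_le_mul hinv (mul_le_mul hstep ht1 ht0 (by norm_num)) (by positivity) (by have := liftC_nonneg d; positivity)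
      _ = 6 * (liftC d / (M : ℝ) ^ 2) := by ring

/-! ## §3 The comb gauge and the covariance of the longitudinal step -/

/-- In its own comb gauge the lift one longitudinal step on is the flat smooth lift there (in the block: `covLift_comb_eq_smoothLift`; across the far face:
both sides vanish). [folklore] -/
theorem covLift_comb_eq_smoothLift_add_e_self {M : ℕ} (hM : 1 ≤ M) (W : Site d → Fin d → (Matrix n n ℂ)ˣ) (Φ : Site d → Fin d → Matrix n n ℂ)
    (y : Site d) (μ : Fin d) :
    covLift M (gaugeAct (btree M W (blk M y)) W) Φ (y + e μ) μ = smoothLift M Φ (y + e μ) μ := by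
  by_cases h : res M y μ = (M : ℤ) - 1
  · have hres : res M (y + e μ) μ = 0 := by rw [res_add_e_self hM]; simp [h]
    unfold covLift
    rw [smoothLift_of_res_self_eq_zero M Φ hres, AveragingDeficitNearIdentity.Ad_zero]
  · have hblk : blk M (y + e μ) = blk M y := by rw [blk_add_e hM]; simp [h]
    exact covLift_comb_eq_smoothLift M W Φ hblk μ

/-- **COVARIANCE OF THE LONGITUDINAL COVARIANT STEP**: for a site gauge `g`, the step of the dressed field at the dressed background is the rotated step:
`Ad_{W^g(y+e_μ,μ)} Y^g(y+e_μ,μ) − Y^g(y,μ) = Ad_{g(y+e_μ)} (Ad_{W(y+e_μ,μ)} Y(y+e_μ,μ) − Y(y,μ))` (`Y^g = dirGauge g Y`). [folklore] -/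
theorem covStep_gaugeAct (g : Site d → (Matrix n n ℂ)ˣ) (W : Site d → Fin d → (Matrix n n ℂ)ˣ) (Y : Site d → Fin d → Matrix n n ℂ) (y : Site d) (μ : Fin d) :
    Ad (gaugeAct g W (y + e μ) μ) (dirGauge g Y (y + e μ) μ) - dirGauge g Y y μ
      = Ad (g (y + e μ)) (Ad (W (y + e μ) μ) (Y (y + e μ) μ) - Y y μ) := by
  unfold gaugeAct dirGauge
  rw [Ad_mul, Ad_mul, ← Ad_mul (g (y + e μ + e μ))⁻¹ (g (y + e μ + e μ)), inv_mul_cancel, AveragingDeficitNearIdentity.Ad_one, Ad_sub]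

/-! ## §4 The covariant longitudinal step of the transported lift, pointwise -/

/-- **THE COVARIANT LONGITUDINAL STEP OF THE TRANSPORTED LIFT, POINTWISE** (`M ≥ 2`, unitary `W` with `SmallField W x_W`):
`‖Ad_{W(y+e_μ,μ)} covLift M W Φ (y+e_μ) μ − covLift M W Φ y μ‖ ≤ liftC·(6∕M² + 2(d+1)·x_W)·‖Φ(blk y, μ)‖`. [folklore] -/
theorem norm_covStep_covLift_le [Nonempty n] {M : ℕ} (hM : 2 ≤ M) {W : Site d → Fin d → (Matrix n n ℂ)ˣ} (hWu : IsUnitaryCfg W)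
    {a : ℝ} (ha : 0 ≤ a) (hWa : SmallField W a) (Φ : Site d → Fin d → Matrix n n ℂ) (y : Site d) (μ : Fin d) :
    ‖Ad (W (y + e μ) μ) (covLift M W Φ (y + e μ) μ) - covLift M W Φ y μ‖
      ≤ liftC d * (6 / (M : ℝ) ^ 2 + 2 * ((d : ℝ) + 1) * a) * ‖Φ (blk M y) μ‖ := by
  have hM1 : 1 ≤ M := by omega
  have hd : 1 ≤ d := μ.pos
  have hM0 : (0 : ℝ) < (M : ℝ) := by exact_mod_cast (show 0 < M by omega)
  -- the comb gauge of the block and the corner-rotated coarse field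
  set g : Site d → (Matrix n n ℂ)ˣ := btree M W (blk M y) with hg
  set Wc : Site d → Fin d → (Matrix n n ℂ)ˣ := gaugeAct g W with hWc
  set Φg : Site d → Fin d → Matrix n n ℂ := fun z' κ => Ad (g ((M : ℤ) • (z' + e κ))) (Φ z' κ) with hΦg
  have hgu : ∀ w, g w ∈ unitaryUnits (Matrix n n ℂ) := fun w => btree_mem hWu M _ w
  have hWcu : IsUnitaryCfg Wc := isUnitaryCfg_comb hWu M _
  have hΦgn : ∀ (z' : Site d) (κ : Fin d), ‖Φg z' κ‖ = ‖Φ z' κ‖ := fun z' κ => norm_Ad_of_unitary (hgu _) _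
  -- covariance
  have hcov : covLift M Wc Φg = dirGauge g (covLift M W Φ) := by rw [hWc, hΦg, covLift_gaugeAct]; rfl
  have hstep : Ad (Wc (y + e μ) μ) (covLift M Wc Φg (y + e μ) μ) - covLift M Wc Φg y μ
      = Ad (g (y + e μ)) (Ad (W (y + e μ) μ) (covLift M W Φ (y + e μ) μ) - covLift M W Φ y μ) := by
    rw [hcov, hWc, covStep_gaugeAct]
  have hnorm : ‖Ad (W (y + e μ) μ) (covLift M W Φ (y + e μ) μ) - covLift M W Φ y μ‖
      = ‖Ad (Wc (y + e μ) μ) (covLift M Wc Φg (y + e μ) μ) - covLift M Wc Φg y μ‖ := by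
    rw [hstep, norm_Ad_of_unitary (hgu _)]
  -- in the comb gauge the lift is the flat smooth lift on both bonds
  have h0 : covLift M Wc Φg y μ = smoothLift M Φg y μ := covLift_comb_eq_smoothLift M W Φg rfl μ
  have h1 : covLift M Wc Φg (y + e μ) μ = smoothLift M Φg (y + e μ) μ := covLift_comb_eq_smoothLift_add_e_self hM1 W Φg y μ
  rw [hnorm, h0, h1]
  -- sizes
  set δ : ℝ := ((d : ℝ) * ((M : ℝ) - 1) + 1) * a with hδ
  have hδ0 : 0 ≤ δ := by
    rw [hδ]; have : (1 : ℝ) ≤ M := by exact_mod_cast hM1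
    have : 0 ≤ (d : ℝ) * ((M : ℝ) - 1) + 1 := by nlinarith
    positivity
  have heμ : (0 : Site d) ≤ e μ ∧ l1 (e μ : Site d) ≤ 1 :=
    ⟨fun i => by simp only [Pi.zero_apply, e_apply]; split_ifs <;> norm_num, by rw [l1_e]⟩
  have hbond : ‖((Wc (y + e μ) μ : (Matrix n n ℂ)ˣ) : Matrix n n ℂ) - 1‖ ≤ δ := norm_comb_plaquette_bond_le hM1 hWu ha hWa y μ (e μ) heμ.1 heμ.2
  have hSL1 : ‖smoothLift M Φg (y + e μ) μ‖ ≤ liftC d / M * ‖Φ (blk M y) μ‖ := by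
    have h := norm_smoothLift_add_e_self_le hM hd Φg y μ; rwa [hΦgn] at h
  have hSLstep : ‖smoothLift M Φg (y + e μ) μ - smoothLift M Φg y μ‖ ≤ 6 * (liftC d / (M : ℝ) ^ 2) * ‖Φ (blk M y) μ‖ := by
    have h := norm_smoothLift_longStep_le hM hd Φg y μ; rwa [hΦgn] at h
  have htrans : ‖Ad (Wc (y + e μ) μ) (smoothLift M Φg (y + e μ) μ) - smoothLift M Φg (y + e μ) μ‖ ≤ 2 * δ * (liftC d / M * ‖Φ (blk M y) μ‖) :=
    (norm_Ad_sub_le (hWcu _ μ) _).trans (mul_le_mul (mul_le_mul_of_nonneg_left hbond (by norm_num)) hSL1 (norm_nonneg _) (by positivity))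
  -- `2δ·(liftC∕M) ≤ 2(d+1)a·liftC`
  have hδM : δ / M ≤ ((d : ℝ) + 1) * a := by
    rw [hδ, div_le_iff₀ hM0]
    have h1M : (1 : ℝ) ≤ M := by exact_mod_cast hM1
    have hd0 : (0 : ℝ) ≤ d := Nat.cast_nonneg d
    nlinarith [mul_nonneg hd0 ha, mul_nonneg (sub_nonneg.2 h1M) ha]
  have hS0 : 0 ≤ ‖Φ (blk M y) μ‖ := norm_nonneg _
  calc ‖Ad (Wc (y + e μ) μ) (smoothLift M Φg (y + e μ) μ) - smoothLift M Φg y μ‖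
      ≤ ‖Ad (Wc (y + e μ) μ) (smoothLift M Φg (y + e μ) μ) - smoothLift M Φg (y + e μ) μ‖
          + ‖smoothLift M Φg (y + e μ) μ - smoothLift M Φg y μ‖ := by
        have := norm_add_le (Ad (Wc (y + e μ) μ) (smoothLift M Φg (y + e μ) μ) - smoothLift M Φg (y + e μ) μ)
          (smoothLift M Φg (y + e μ) μ - smoothLift M Φg y μ)
        rwa [sub_add_sub_cancel] at this
    _ ≤ 2 * δ * (liftC d / M * ‖Φ (blk M y) μ‖) + 6 * (liftC d / (M : ℝ) ^ 2) * ‖Φ (blk M y) μ‖ := add_le_add htrans hSLstep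
    _ = (2 * (δ / M)) * (liftC d * ‖Φ (blk M y) μ‖) + 6 * (liftC d / (M : ℝ) ^ 2) * ‖Φ (blk M y) μ‖ := by field_simp
    _ ≤ (2 * (((d : ℝ) + 1) * a)) * (liftC d * ‖Φ (blk M y) μ‖) + 6 * (liftC d / (M : ℝ) ^ 2) * ‖Φ (blk M y) μ‖ := by
        have : 0 ≤ liftC d * ‖Φ (blk M y) μ‖ := mul_nonneg (liftC_nonneg d) hS0
        nlinarith [mul_le_mul_of_nonneg_right hδM this]
    _ = liftC d * (6 / (M : ℝ) ^ 2 + 2 * ((d : ℝ) + 1) * a) * ‖Φ (blk M y) μ‖ := by ring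

/-! ## §5 The covariant divergence of the transported lift: pointwise and in ℓ² -/

/-- The covariant divergence as a sum of longitudinal steps: `covDiv W Y x = Σ_μ (Ad_{W(x,μ)} Y(x,μ) − Y(x−e_μ,μ))` with `x = (x − e_μ) + e_μ`. [folklore] -/
theorem covDiv_eq_sum_covStep (W : Site d → Fin d → (Matrix n n ℂ)ˣ) (Y : Site d → Fin d → Matrix n n ℂ) (x : Site d) :
    covDiv W Y x = ∑ μ : Fin d, (Ad (W ((x - e μ) + e μ) μ) (Y ((x - e μ) + e μ) μ) - Y (x - e μ) μ) := by
  unfold covDiv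
  exact Finset.sum_congr rfl fun μ _ => by rw [sub_add_cancel]

/-- **THE COVARIANT DIVERGENCE OF THE TRANSPORTED LIFT, POINTWISE**: `‖covDiv_W (covLift M W Φ) x‖ ≤ liftC·(6∕M² + 2(d+1)x_W)·Σ_μ ‖Φ(blk(x−e_μ), μ)‖`. [folklore] -/
theorem norm_covDiv_covLift_le [Nonempty n] {M : ℕ} (hM : 2 ≤ M) {W : Site d → Fin d → (Matrix n n ℂ)ˣ} (hWu : IsUnitaryCfg W)
    {a : ℝ} (ha : 0 ≤ a) (hWa : SmallField W a) (Φ : Site d → Fin d → Matrix n n ℂ) (x : Site d) :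
    ‖covDiv W (covLift M W Φ) x‖ ≤ liftC d * (6 / (M : ℝ) ^ 2 + 2 * ((d : ℝ) + 1) * a) * ∑ μ : Fin d, ‖Φ (blk M (x - e μ)) μ‖ := by
  rw [covDiv_eq_sum_covStep, Finset.mul_sum]
  exact (norm_sum_le _ _).trans (Finset.sum_le_sum fun μ _ => norm_covStep_covLift_le hM hWu ha hWa Φ (x - e μ) μ)

/-- **THE DIVERGENCE LETTER IN ℓ² OVER ONE PERIOD** (`M ≥ 2`, unitary `W` with `SmallField W x_W`, `Φ` `N`-periodic, `N ≥ 1`):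
`Σ_{x ∈ periodBox (M·N)} nhsNormSq (covDiv_W (covLift M W Φ) x) ≤ d·liftC²·(6∕M² + 2(d+1)x_W)²·M^d·dirSq Φ (periodBox N)` — in the regime `M²·x_W ≤ 1` the
prefactor is `d(2d+8)²·liftC²·M^{d−4}`: one order of `M²` better than the field's own ℓ²-size `liftC²·M^{d−2}·dirSq Φ` (`NE3RightInverseL2Letter.dirSq_covLift_le`),
which is what makes `Spine/NE3/LandauProjectionB8.sum_nhsNormSq_gaugeDir_le_of_isLandauB8` k-free. [folklore] -/
theorem sum_nhsNormSq_covDiv_covLift_le [Nonempty n] {M : ℕ} (hM : 2 ≤ M) {N : ℕ} (hN : 1 ≤ N) {W : Site d → Fin d → (Matrix n n ℂ)ˣ}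
    (hWu : IsUnitaryCfg W) {a : ℝ} (ha : 0 ≤ a) (hWa : SmallField W a) {Φ : Site d → Fin d → Matrix n n ℂ} (hΦP : IsPeriodicDir Φ (N : ℤ)) :
    ∑ x ∈ periodBox (d := d) (M * N), nhsNormSq (covDiv W (covLift M W Φ) x)
      ≤ (d : ℝ) * (liftC d * (6 / (M : ℝ) ^ 2 + 2 * ((d : ℝ) + 1) * a)) ^ 2 * (M : ℝ) ^ d * dirSq Φ (periodBox (d := d) N) := by
  have hM1 : 1 ≤ M := by omega
  have hP : 1 ≤ M * N := Nat.mul_pos (by omega) (by omega)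
  set C : ℝ := liftC d * (6 / (M : ℝ) ^ 2 + 2 * ((d : ℝ) + 1) * a) with hC
  have hC0 : 0 ≤ C := by rw [hC]; have := liftC_nonneg d; positivity
  -- pointwise: `nhsNormSq ≤ ‖·‖² ≤ (C·Σ_μ f_μ)² ≤ C²·d·Σ_μ f_μ²`
  have hpt : ∀ x : Site d, nhsNormSq (covDiv W (covLift M W Φ) x) ≤ C ^ 2 * ((d : ℝ) * ∑ μ : Fin d, ‖Φ (blk M (x - e μ)) μ‖ ^ 2) := by
    intro x
    have h1 := norm_covDiv_covLift_le hM hWu ha hWa Φ x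
    have h2 : nhsNormSq (covDiv W (covLift M W Φ) x) ≤ ‖covDiv W (covLift M W Φ) x‖ ^ 2 := nhsNormSq_le_opNorm_sq _
    have h3 : ‖covDiv W (covLift M W Φ) x‖ ^ 2 ≤ (C * ∑ μ : Fin d, ‖Φ (blk M (x - e μ)) μ‖) ^ 2 :=
      pow_le_pow_left₀ (norm_nonneg _) (by rw [hC]; exact h1) 2
    have h4 : (∑ μ : Fin d, ‖Φ (blk M (x - e μ)) μ‖) ^ 2 ≤ (d : ℝ) * ∑ μ : Fin d, ‖Φ (blk M (x - e μ)) μ‖ ^ 2 := by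
      have h := sq_sum_le_card_mul_sum_sq (s := (Finset.univ : Finset (Fin d))) (f := fun μ => ‖Φ (blk M (x - e μ)) μ‖)
      simpa [Finset.card_univ, Fintype.card_fin] using h
    calc nhsNormSq (covDiv W (covLift M W Φ) x) ≤ (C * ∑ μ : Fin d, ‖Φ (blk M (x - e μ)) μ‖) ^ 2 := h2.trans h3
      _ = C ^ 2 * (∑ μ : Fin d, ‖Φ (blk M (x - e μ)) μ‖) ^ 2 := by ring
      _ ≤ C ^ 2 * ((d : ℝ) * ∑ μ : Fin d, ‖Φ (blk M (x - e μ)) μ‖ ^ 2) := mul_le_mul_of_nonneg_left h4 (sq_nonneg C)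
  -- sum over the period box; shift each `μ`-summand by `e_μ`; count blocks
  have hper : ∀ (μ : Fin d) (x : Site d) (κ : Fin d), ‖Φ (blk M (x + ((M * N : ℕ) : ℤ) • e κ)) μ‖ ^ 2 = ‖Φ (blk M x) μ‖ ^ 2 := by
    intro μ x κ
    have hb : blk M (x + ((M * N : ℕ) : ℤ) • e κ) = blk M x + (N : ℤ) • e κ := by
      have h := (blk_res_add_period (d := d) hM1 x (N : ℤ) κ).1
      have hP : ((M * N : ℕ) : ℤ) = (M : ℤ) * (N : ℤ) := by push_cast; ring
      rw [hP]; exact h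
    rw [hb, hΦP]
  have hshift : ∀ μ : Fin d, ∑ x ∈ periodBox (d := d) (M * N), ‖Φ (blk M (x - e μ)) μ‖ ^ 2
      = ∑ x ∈ periodBox (d := d) (M * N), ‖Φ (blk M x) μ‖ ^ 2 := by
    intro μ
    have h := sum_periodBox_shift (d := d) (M * N) hP (g := fun x' => ‖Φ (blk M x') μ‖ ^ 2) (hper μ) (-e μ)
    simpa [sub_eq_add_neg] using h
  have hblocks : ∀ μ : Fin d, ∑ x ∈ periodBox (d := d) (M * N), ‖Φ (blk M x) μ‖ ^ 2 = (M : ℝ) ^ d * ∑ z ∈ periodBox (d := d) N, ‖Φ z μ‖ ^ 2 := by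
    intro μ
    rw [← sum_periodBox_blocks M N hM1, Finset.mul_sum]
    refine Finset.sum_congr rfl fun z _ => ?_
    rw [Finset.sum_congr rfl fun v hv => by rw [blk_block hM1 z hv], Finset.sum_const, card_periodBox, nsmul_eq_mul, Nat.cast_pow]
  calc ∑ x ∈ periodBox (d := d) (M * N), nhsNormSq (covDiv W (covLift M W Φ) x)
      ≤ ∑ x ∈ periodBox (d := d) (M * N), C ^ 2 * ((d : ℝ) * ∑ μ : Fin d, ‖Φ (blk M (x - e μ)) μ‖ ^ 2) := Finset.sum_le_sum fun x _ => hpt x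
    _ = C ^ 2 * (d : ℝ) * ∑ μ : Fin d, ∑ x ∈ periodBox (d := d) (M * N), ‖Φ (blk M (x - e μ)) μ‖ ^ 2 := by
        rw [Finset.sum_comm, ← Finset.mul_sum, ← Finset.mul_sum, mul_assoc]
    _ = C ^ 2 * (d : ℝ) * ∑ μ : Fin d, ((M : ℝ) ^ d * ∑ z ∈ periodBox (d := d) N, ‖Φ z μ‖ ^ 2) := by
        congr 1; exact Finset.sum_congr rfl fun μ _ => by rw [hshift μ, hblocks μ]
    _ = C ^ 2 * (d : ℝ) * ((M : ℝ) ^ d * dirSq Φ (periodBox (d := d) N)) := by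
        rw [← Finset.mul_sum]
        unfold T4AveragingDeficitWall.dirSq
        rw [Finset.sum_comm]
    _ = (d : ℝ) * C ^ 2 * (M : ℝ) ^ d * dirSq Φ (periodBox (d := d) N) := by ring

end

end Summit.QuantumFields.BalabanUV.T4Continuum.NE3.CovLiftDivergenceB8
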